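import Summits.PneNP.PneNP.Theorems.SymmetryBudgetNoHiddenOrderProgramSrcsD
import Summits.PneNP.PneNP.Theorems.SymmetryBudgetNoHiddenOrderWindowReadout

/-!
# `NoHiddenOrder` (stmt-PneNP-14781), (R2c) VI: the window canoniser program — semantics of the output layer

Route `PneNP/SymmetryBudget`; companion of `…ProgramSrcsD.lean` (seat -1's dispatch).  For ANY `P : SymProg (Fin m × Fin m) (Gt m)` whose
kinds and sources are the dispatch `WCanon.kind` / `WCanon.srcs` (the rank is irrelevant), the output layer computes the bit readout
`GraphReadout.outB` of `…WindowReadout.lean` from the root value and the root colour tests: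

* `sem_adjO` — `adjO u b` carries the symmetrised adjacency `(rootGraph x).Adj u b`;
* `sem_woc` — `woc a b u c` carries `E (cIdx (wposW u a) c) ∧ [colw u = c] ∧ (rootGraph x).Adj u b`;
* **`sem_out_eq_outB`** — `P.sem x (out q) = outB (windowSet m) le_rfl (rootGraph x) colw E q`, given that the root label's value bits read `E`
  (`∀ β, P.sem x (vl (rootLab m h) (bit β)) = E β`) and the root colour tests read `[colw u = c]` on the window
  (`∀ u c, P.sem x (root (vval u c)) = decide (colw u = c)`).
So `GraphProgram.sound` for this program is `window_sound_of_good` (`…WindowSoundGood.lean`) applied to the root value, once the value /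
refinement modules identify `E` and `colw`.  Sorry-free; supports stmt-PneNP-14781, does not close it.
-/

set_option linter.dupNamespace false -- `Summit.PneNP.PneNP.…` (D-0017 single-conjunct layout)

namespace Summit.PneNP.PneNP.Theorems

open Finset CGBits BranchSum Literature.Computability.Complexity Literature.Computability.Complexity.SymProg GraphReadout

namespace WCanon

variable {m : ℕ} (P : SymProg (Fin m × Fin m) (Gt m)) (hk : ∀ l, P.kind l = kind l) (hs : ∀ l, P.srcs l = srcs l)
  (x : Fin m × Fin m → Bool)

/-! ### Adjacency gates -/

/-- The symmetrised adjacency of the input matrix is the adjacency of `rootGraph x`. [folklore] -/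
theorem rootGraph_adj_iff (a b : Fin m) : (rootGraph x).Adj a b ↔ a ≠ b ∧ (x (a, b) = true ∨ x (b, a) = true) :=
  SimpleGraph.fromRel_adj _ _ _

include hk hs in
/-- **`adjO u b` carries the symmetrised adjacency of `u` and `b`.** [folklore] -/
theorem sem_adjO [DecidableRel (rootGraph x).Adj] (u : WV m) (b : Fin m) :
    P.sem x (Gt.adjO u b) = decide ((rootGraph x).Adj u.1 b) := by
  have hko : P.kind (Gt.adjO u b) = Kind.or := by rw [hk]; rfl
  rw [Bool.eq_iff_iff, P.sem_or hko, hs, decide_eq_true_iff, rootGraph_adj_iff]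
  simp only [srcs]
  split_ifs with h
  · simp [h]
  · simp only [mem_insert, mem_singleton, exists_eq_or_imp, exists_eq_left, wval_inl]
    exact ⟨fun h' => ⟨h, h'⟩, fun h' => h'.2⟩

include hk hs in
/-- **`adjW u v` carries the symmetrised adjacency of two window vertices.** [folklore] -/
theorem sem_adjW [DecidableRel (rootGraph x).Adj] (u v : WV m) :
    P.sem x (Gt.adjW u v) = decide ((rootGraph x).Adj u.1 v.1) := by
  have hko : P.kind (Gt.adjW u v) = Kind.or := by rw [hk]; rfl
  rw [Bool.eq_iff_iff, P.sem_or hko, hs, decide_eq_true_iff, rootGraph_adj_iff]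
  simp only [srcs]
  split_ifs with h
  · subst h; simp
  · have h' : u.1 ≠ v.1 := fun e => h (Subtype.ext e)
    simp only [mem_insert, mem_singleton, exists_eq_or_imp, exists_eq_left, wval_inl]
    exact ⟨fun h'' => ⟨h', h''⟩, fun h'' => h''.2⟩

/-! ### Output helpers -/

section Out

variable {h0 : 0 < wn m} (E : BVal (wn m)) (hE : ∀ β, P.sem x (Gt.vl (rootLab m h0) (.bit β)) = E β)
  (colw : Fin m → ℕ) (hcol : ∀ (u : WV m) (c : Fin (wn m)), P.sem x (Gt.root (.vval u c)) = decide (colw u.1 = c))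

/-- Every root label is the given one. -/
theorem rootLabOf_eq (u : WV m) (h : 0 < wn m) : rootLabOf u = rootLab m h := rfl

include hk hs hE hcol in
/-- **`woc a b u c` carries: bit `cIdx (wposW u a) c` of the root value, the colour test `colw u = c`, and `u ~ b`.** [folklore] -/
theorem sem_woc [DecidableRel (rootGraph x).Adj] (a b : Fin m) (u : WV m) (c : Fin (wn m)) :
    P.sem x (Gt.woc a b u c) = (E (cIdx (wposW u a) c) && decide (colw u.1 = c) && decide ((rootGraph x).Adj u.1 b)) := by
  have hka : P.kind (Gt.woc a b u c) = Kind.and := by rw [hk]; rfl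
  rw [Bool.eq_iff_iff, P.sem_and hka, hs]
  simp only [srcs, mem_insert, mem_singleton, forall_eq_or_imp, forall_eq, wval_inr, rootLabOf_eq u h0, hE, hcol,
    sem_adjO P hk hs x, Bool.and_eq_true]
  tauto

/-- The window position of a window index is its row. [folklore] -/
theorem wposW_eq_wrow (u : WV m) (a : Fin m) (ha : a ∈ Summit.PneNP.PneNP.Theorems.windowSet m) :
    wposW u a = wrow (Summit.PneNP.PneNP.Theorems.windowSet m) (le_refl (wn m)) a ha := by
  unfold wposW
  rw [dif_pos ha]
  rfl

include hk hs hE hcol in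
/-- **The output gates compute the bit readout `outB` of the root value.** [folklore] -/
theorem sem_out_eq_outB [DecidableRel (rootGraph x).Adj] (q : Fin m × Fin m) :
    P.sem x (Gt.out q) = outB (Summit.PneNP.PneNP.Theorems.windowSet m) (le_refl (wn m)) (rootGraph x) colw E q := by
  have hko : P.kind (Gt.out q) = Kind.or := by rw [hk]; rfl
  rw [Bool.eq_iff_iff, P.sem_or hko, hs]
  unfold outB
  simp only [srcs]
  by_cases ha : q.1 ∈ Summit.PneNP.PneNP.Theorems.windowSet m
  · by_cases hb : q.2 ∈ Summit.PneNP.PneNP.Theorems.windowSet m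
    · -- window × window: one root value bit
      rw [dif_pos ha, dif_pos hb, dif_pos ha, dif_pos hb]
      simp only [mem_singleton, exists_eq_left, wval_inr, hE]
      rfl
    · -- window × ordered: an OR over the helpers `woc q.1 q.2 u c`
      rw [dif_pos ha, dif_neg hb, dif_pos ha, dif_neg hb, decide_eq_true_iff]
      simp only [mem_image, mem_univ, true_and]
      constructor
      · rintro ⟨_, ⟨⟨u, c⟩, rfl⟩, hw⟩
        rw [wval_inr, sem_woc P hk hs x E hE colw hcol] at hw
        simp only [Bool.and_eq_true, decide_eq_true_eq] at hw
        refine ⟨c, ?_, u.1, u.2, hw.1.2, ((rootGraph x).adj_comm _ _).1 hw.2⟩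
        rw [← wposW_eq_wrow u]; exact hw.1.1
      · rintro ⟨c, hc, u, hu, hcu, hadj⟩
        refine ⟨_, ⟨⟨⟨u, hu⟩, c⟩, rfl⟩, ?_⟩
        rw [wval_inr, sem_woc P hk hs x E hE colw hcol]
        simp only [Bool.and_eq_true, decide_eq_true_eq]
        exact ⟨⟨by rw [wposW_eq_wrow ⟨u, hu⟩ q.1 ha]; exact hc, hcu⟩, ((rootGraph x).adj_comm _ _).1 hadj⟩
  · by_cases hb : q.2 ∈ Summit.PneNP.PneNP.Theorems.windowSet m
    · -- ordered × window: the symmetric OR over `woc q.2 q.1 u c`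
      rw [dif_neg ha, if_pos hb, dif_neg ha, dif_pos hb, decide_eq_true_iff]
      simp only [mem_image, mem_univ, true_and]
      constructor
      · rintro ⟨_, ⟨⟨u, c⟩, rfl⟩, hw⟩
        rw [wval_inr, sem_woc P hk hs x E hE colw hcol] at hw
        simp only [Bool.and_eq_true, decide_eq_true_eq] at hw
        refine ⟨c, ?_, u.1, u.2, hw.1.2, ((rootGraph x).adj_comm _ _).1 hw.2⟩
        rw [← wposW_eq_wrow u]; exact hw.1.1
      · rintro ⟨c, hc, u, hu, hcu, hadj⟩
        refine ⟨_, ⟨⟨⟨u, hu⟩, c⟩, rfl⟩, ?_⟩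
        rw [wval_inr, sem_woc P hk hs x E hE colw hcol]
        simp only [Bool.and_eq_true, decide_eq_true_eq]
        exact ⟨⟨by rw [wposW_eq_wrow ⟨u, hu⟩ q.2 hb]; exact hc, hcu⟩, ((rootGraph x).adj_comm _ _).1 hadj⟩
    · -- ordered × ordered: the input entries
      rw [dif_neg ha, if_neg hb, dif_neg ha, dif_neg hb, decide_eq_true_iff, rootGraph_adj_iff]
      split_ifs with hq
      · simp [hq]
      · simp only [mem_insert, mem_singleton, exists_eq_or_imp, exists_eq_left, wval_inl, Prod.mk.eta]
        exact ⟨fun h' => ⟨hq, h'⟩, fun h' => h'.2⟩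

end Out

end WCanon

end Summit.PneNP.PneNP.Theorems
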